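import Summits.NavierStokesRegularity.NavierStokesRegularity.Theses.AdaptedFrequency
import Literature.Analysis.FluidPDE.AdaptedBackwardKernel
import Summits.NavierStokesRegularity.NavierStokesRegularity.Theorems.AdaptedFrequencyAdaptedFrequencyConvergesStubPinchingLower
import Summits.NavierStokesRegularity.NavierStokesRegularity.Theorems.AdaptedFrequencyAdaptedFrequencyConvergesStubPinchingUpper
import Summits.NavierStokesRegularity.NavierStokesRegularity.Theorems.AdaptedFrequencyAdaptedFrequencyConvergesStubEnstrophyC2
import Summits.NavierStokesRegularity.NavierStokesRegularity.Theorems.AdaptedFrequencyAdaptedFrequencyConvergesLimitTwoCore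

/-!
# The adapted frequency clusters at `2`, and `2` is its only possible limit
(crux stmt-NavierStokesRegularity-10493 `AdaptedFrequency.AdaptedFrequencyConverges`; rung of line
`birkhoff-recurrent-hull`, lands `--supports stmt-NavierStokesRegularity-10493`)

Under the hypotheses of the crux (classical NS on `ℝ³ × [0,T)`, Leray–Hopf from a rapidly decaying
datum, Type-I rate, `(T, x₀)` backward-singular, `G` a Gaussian-comparable flow-adapted backward
kernel on `[t₀, T)`), with `H = adaptedEnstrophy u G` and `Λ = adaptedFrequency u G T`
(`Λ t = (T − t) H′(t)/H(t)`):

* `frequently_lt_two_add`, `frequently_two_sub_lt` — for every `ε > 0`, `Λ < 2 + ε` and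
  `2 − ε < Λ` FREQUENTLY as `t ↑ T` (so `liminf Λ ≤ 2 ≤ limsup Λ`);
* `mapClusterPt_two` — `2` is a cluster value of `Λ` at `T⁻` (`MapClusterPt 2 (𝓝[<] T) Λ`);
* `limit_eq_two` — if `Λ → Λ₀` as `t ↑ T` then `Λ₀ = 2`; `limit_eq_two_inline` is the same with the
  crux's hypotheses spelled verbatim (five kernel clauses, comparability, `H`, `Λ` as in the route
  file), and `tendsto_two_of_adaptedFrequencyConverges` records that the crux is equivalent to
  `Λ → 2`.

Mechanism (pure real analysis — `…LimitTwoCore` — over three LANDED stubs of the crux: the enstrophy floor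
`c₀ ≤ (T−t)² H` — `TauberianOmegaLimit.stub_pinchingLower`, p82804, the far-field input; the ceiling
`(T−t)² H ≤ C₁` — `TauberianOmegaLimit.stub_pinchingUpper`, p78510; and `H ∈ C²` near `T` —
`UnsteadinessSqueeze.stub_enstrophyC2`, p103653): the logarithmic clock `log((T−t)² H(t))` is
BOUNDED on a final window and has derivative `(Λ(t) − 2)/(T − t)`; if `Λ ≥ 2 + δ` (resp. `≤ 2 − δ`)
held on a whole left neighbourhood of `T`, the clock `log H + (2 ± δ)·log(T − ·)` would be monotone
and force `log((T−t)²H) → ∓∞`.  Two-sidedness of the cluster value uses the continuity of `Λ`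
(from `H ∈ C²`, `H > 0`) and the intermediate value theorem.  On the disprover's linear bench
(`Cruxes/AdaptedFrequencyConverges/Disproof.lean` §4: no floor, `Λ = 2ε cos log(1−t)`, Cesàro mean `0`)
the conclusion fails, as it must: the rung consumes the far-field input through the floor.
What it says about a counterexample to the crux: its frequency oscillates ACROSS the self-similar
value `2` for ever (it cannot stay on one side and fail to converge by drifting), in line with the
breather picture of `…OfNoRecurrentPinchedPair`.
-/

noncomputable section

open scoped Topology
open Literature.Analysis.FluidPDE Set Filter MeasureTheory
open Summit.NavierStokesRegularity.NavierStokesRegularity.Theses.AdaptedFrequency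

set_option linter.dupNamespace false

namespace Summit.NavierStokesRegularity.NavierStokesRegularity.Theorems.AdaptedFrequencyConverges.LimitTwo

/-! ### The pinched `C²` window of the adapted enstrophy (three landed stubs) -/

/-- **Pinched `C²` window.** Under the crux hypotheses there are `a ∈ [t₀, T)` and
`0 < c₀`, `C₁` with `adaptedEnstrophy u G` of class `C²` on `(a, T)` and
`c₀ ≤ (T − t)² H(t) ≤ C₁` there — the conjunction of the landed stubs `stub_pinchingLower`
(p82804), `stub_pinchingUpper` (p78510) and `stub_enstrophyC2` (p103653) on a common window. -/
theorem pinchedWindow {ν T t₀ : ℝ} {u : ℝ → EuclideanSpace ℝ (Fin 3) → EuclideanSpace ℝ (Fin 3)}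
    {p : ℝ → EuclideanSpace ℝ (Fin 3) → ℝ} {x₀ : EuclideanSpace ℝ (Fin 3)}
    {G : ℝ → EuclideanSpace ℝ (Fin 3) → ℝ} (hν : 0 < ν) (hT : 0 < T)
    (hcl : IsClassicalNSSolutionOn (Ico 0 T) ν 0 u p) (hLH : IsLerayHopfOn T ν 0 (u 0) u)
    (hdec : HasRapidSpatialDecay (u 0)) (hTI : IsTypeIBlowup u T) (ht₀ : t₀ ∈ Ico 0 T)
    (hsing : ∀ r : ℝ, 0 < r →
      eLpNorm (Function.uncurry u) ⊤ (volume.restrict (parabolicCylinder r (T, x₀))) = ⊤)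
    (hker : IsAdaptedBackwardKernel ν u (Ico t₀ T) T x₀ G)
    (hcmp : IsGaussianComparable G (Ico t₀ T) T x₀) :
    ∃ a c₀ C₁ : ℝ, t₀ ≤ a ∧ a < T ∧ 0 < c₀ ∧
      ContDiffOn ℝ 2 (adaptedEnstrophy u G) (Ioo a T) ∧
      ∀ t ∈ Ioo a T, c₀ ≤ (T - t) ^ 2 * adaptedEnstrophy u G t ∧
        (T - t) ^ 2 * adaptedEnstrophy u G t ≤ C₁ := by
  obtain ⟨t₁, ht₁, c₀, hc₀, hfloor⟩ :=
    TauberianOmegaLimit.stub_pinchingLower ν T u p x₀ t₀ G hν hT hcl hLH hdec hTI ht₀ hsing hker hcmp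
  obtain ⟨t₂, ht₂, C₁, hceil⟩ :=
    TauberianOmegaLimit.stub_pinchingUpper ν T u p x₀ t₀ G hν hT hcl hLH hdec hTI ht₀ hsing hker hcmp
  obtain ⟨t₃, ht₃, hC2⟩ :=
    UnsteadinessSqueeze.stub_enstrophyC2 ν T u p x₀ t₀ G hν hT hcl hLH hdec hTI ht₀ hsing hker hcmp
  refine ⟨max (max t₁ t₂) t₃, c₀, C₁, ?_, max_lt (max_lt ht₁.2 ht₂.2) ht₃.2, hc₀,
    hC2.mono (Ioo_subset_Ioo_left (le_max_right _ _)), fun t ht => ⟨?_, ?_⟩⟩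
  · exact ht₁.1.trans ((le_max_left _ _).trans (le_max_left _ _))
  · exact hfloor t ⟨((le_max_left _ _).trans (le_max_left _ _)).trans ht.1.le, ht.2⟩
  · exact hceil t ⟨((le_max_right _ _).trans (le_max_left _ _)).trans ht.1.le, ht.2⟩

/-! ### The rung: `2` is a cluster value of `Λ` and its only possible limit -/

section Crux

variable {ν T t₀ : ℝ} {u : ℝ → EuclideanSpace ℝ (Fin 3) → EuclideanSpace ℝ (Fin 3)}
  {p : ℝ → EuclideanSpace ℝ (Fin 3) → ℝ} {x₀ : EuclideanSpace ℝ (Fin 3)}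
  {G : ℝ → EuclideanSpace ℝ (Fin 3) → ℝ}

/-- **`Λ < 2 + ε` frequently.** Under the crux hypotheses, for every `ε > 0` the adapted
frequency is `< 2 + ε` frequently as `t ↑ T` (equivalently `liminf_{t↑T} Λ ≤ 2`): otherwise
`Λ ≥ 2 + ε` on a left neighbourhood of `T`, contradicting the upper pinching
(`not_frequency_ge_of_upperPinching`). -/
theorem frequently_lt_two_add (hν : 0 < ν) (hT : 0 < T)
    (hcl : IsClassicalNSSolutionOn (Ico 0 T) ν 0 u p) (hLH : IsLerayHopfOn T ν 0 (u 0) u)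
    (hdec : HasRapidSpatialDecay (u 0)) (hTI : IsTypeIBlowup u T) (ht₀ : t₀ ∈ Ico 0 T)
    (hsing : ∀ r : ℝ, 0 < r →
      eLpNorm (Function.uncurry u) ⊤ (volume.restrict (parabolicCylinder r (T, x₀))) = ⊤)
    (hker : IsAdaptedBackwardKernel ν u (Ico t₀ T) T x₀ G)
    (hcmp : IsGaussianComparable G (Ico t₀ T) T x₀) {ε : ℝ} (hε : 0 < ε) :
    ∃ᶠ t in 𝓝[<] T, adaptedFrequency u G T t < 2 + ε := by
  obtain ⟨a, c₀, C₁, -, haT, hc₀, hC2, hpinch⟩ :=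
    pinchedWindow hν hT hcl hLH hdec hTI ht₀ hsing hker hcmp
  by_contra h
  rw [Filter.not_frequently] at h
  obtain ⟨b, hb, hsub⟩ := mem_nhdsLT_iff_exists_Ioo_subset.1 h
  have hbT : b < T := hb
  set a' : ℝ := max a b with ha'
  have ha'T : a' < T := max_lt haT hbT
  have hsub' : Ioo a' T ⊆ Ioo a T := Ioo_subset_Ioo_left (le_max_left _ _)
  have hpos : ∀ t ∈ Ioo a' T, 0 < adaptedEnstrophy u G t := by
    intro t ht
    have h1 := (hpinch t (hsub' ht)).1
    have h2 : 0 < (T - t) ^ 2 := pow_pos (sub_pos.2 ht.2) 2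
    by_contra hle
    push Not at hle
    have : (T - t) ^ 2 * adaptedEnstrophy u G t ≤ 0 := mul_nonpos_of_nonneg_of_nonpos h2.le hle
    linarith
  refine not_frequency_ge_of_upperPinching (H := adaptedEnstrophy u G) ha'T hε
    ((hC2.differentiableOn (by norm_num)).mono hsub') hpos
    (fun t ht => (hpinch t (hsub' ht)).2) fun t ht => ?_
  have := hsub ⟨(le_max_right a b).trans_lt ht.1, ht.2⟩
  simp only [mem_setOf_eq, not_lt] at this
  exact this

/-- **`2 − ε < Λ` frequently.** Under the crux hypotheses, for every `ε > 0` the adapted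
frequency is `> 2 − ε` frequently as `t ↑ T` (equivalently `limsup_{t↑T} Λ ≥ 2`): otherwise
`Λ ≤ 2 − ε` on a left neighbourhood of `T`, contradicting the lower pinching
(`not_frequency_le_of_lowerPinching`) — this is where the far-field input (the enstrophy floor)
enters. -/
theorem frequently_two_sub_lt (hν : 0 < ν) (hT : 0 < T)
    (hcl : IsClassicalNSSolutionOn (Ico 0 T) ν 0 u p) (hLH : IsLerayHopfOn T ν 0 (u 0) u)
    (hdec : HasRapidSpatialDecay (u 0)) (hTI : IsTypeIBlowup u T) (ht₀ : t₀ ∈ Ico 0 T)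
    (hsing : ∀ r : ℝ, 0 < r →
      eLpNorm (Function.uncurry u) ⊤ (volume.restrict (parabolicCylinder r (T, x₀))) = ⊤)
    (hker : IsAdaptedBackwardKernel ν u (Ico t₀ T) T x₀ G)
    (hcmp : IsGaussianComparable G (Ico t₀ T) T x₀) {ε : ℝ} (hε : 0 < ε) :
    ∃ᶠ t in 𝓝[<] T, 2 - ε < adaptedFrequency u G T t := by
  obtain ⟨a, c₀, C₁, -, haT, hc₀, hC2, hpinch⟩ :=
    pinchedWindow hν hT hcl hLH hdec hTI ht₀ hsing hker hcmp
  by_contra h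
  rw [Filter.not_frequently] at h
  obtain ⟨b, hb, hsub⟩ := mem_nhdsLT_iff_exists_Ioo_subset.1 h
  have hbT : b < T := hb
  set a' : ℝ := max a b with ha'
  have ha'T : a' < T := max_lt haT hbT
  have hsub' : Ioo a' T ⊆ Ioo a T := Ioo_subset_Ioo_left (le_max_left _ _)
  refine not_frequency_le_of_lowerPinching (H := adaptedEnstrophy u G) ha'T hε hc₀
    ((hC2.differentiableOn (by norm_num)).mono hsub')
    (fun t ht => (hpinch t (hsub' ht)).1) fun t ht => ?_
  have := hsub ⟨(le_max_right a b).trans_lt ht.1, ht.2⟩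
  simp only [mem_setOf_eq, not_lt] at this
  exact this

/-- **`2` is a cluster value of the adapted frequency at `T⁻`.** Under the crux hypotheses,
`MapClusterPt 2 (𝓝[<] T) (adaptedFrequency u G T)`: for every `ε > 0`, `|Λ t − 2| < ε` frequently
as `t ↑ T`.  From the two one-sided statements and the continuity of `Λ` on a final window
(`H ∈ C²`, `H > 0`) by the intermediate value theorem. -/
theorem mapClusterPt_two (hν : 0 < ν) (hT : 0 < T)
    (hcl : IsClassicalNSSolutionOn (Ico 0 T) ν 0 u p) (hLH : IsLerayHopfOn T ν 0 (u 0) u)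
    (hdec : HasRapidSpatialDecay (u 0)) (hTI : IsTypeIBlowup u T) (ht₀ : t₀ ∈ Ico 0 T)
    (hsing : ∀ r : ℝ, 0 < r →
      eLpNorm (Function.uncurry u) ⊤ (volume.restrict (parabolicCylinder r (T, x₀))) = ⊤)
    (hker : IsAdaptedBackwardKernel ν u (Ico t₀ T) T x₀ G)
    (hcmp : IsGaussianComparable G (Ico t₀ T) T x₀) :
    MapClusterPt 2 (𝓝[<] T) (adaptedFrequency u G T) := by
  rw [mapClusterPt_iff_frequently]
  intro s hs
  obtain ⟨ε, hε, hball⟩ := Metric.mem_nhds_iff.1 hs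
  suffices h : ∃ᶠ t in 𝓝[<] T, |adaptedFrequency u G T t - 2| < ε by
    refine h.mono fun t ht => hball ?_
    rw [Metric.mem_ball, Real.dist_eq]
    exact ht
  by_contra h
  rw [Filter.not_frequently] at h
  obtain ⟨a, c₀, C₁, -, haT, hc₀, hC2, hpinch⟩ :=
    pinchedWindow hν hT hcl hLH hdec hTI ht₀ hsing hker hcmp
  obtain ⟨b, hb, hsub⟩ := mem_nhdsLT_iff_exists_Ioo_subset.1 h
  have hbT : b < T := hb
  set a' : ℝ := max a b with ha'
  have ha'T : a' < T := max_lt haT hbT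
  have hsub' : Ioo a' T ⊆ Ioo a T := Ioo_subset_Ioo_left (le_max_left _ _)
  have hpos : ∀ t ∈ Ioo a T, 0 < adaptedEnstrophy u G t := by
    intro t ht
    have h1 := (hpinch t ht).1
    have h2 : 0 < (T - t) ^ 2 := pow_pos (sub_pos.2 ht.2) 2
    by_contra hle
    push Not at hle
    have : (T - t) ^ 2 * adaptedEnstrophy u G t ≤ 0 := mul_nonpos_of_nonneg_of_nonpos h2.le hle
    linarith
  -- on `(a', T)`: `|Λ − 2| ≥ ε` and `Λ` is continuous
  have hfar : ∀ t ∈ Ioo a' T, ε ≤ |adaptedFrequency u G T t - 2| := by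
    intro t ht
    have := hsub ⟨(le_max_right a b).trans_lt ht.1, ht.2⟩
    simp only [mem_setOf_eq, not_lt] at this
    exact this
  have hcont : ContinuousOn (adaptedFrequency u G T) (Ioo a' T) := by
    have := (continuousOn_frequency (T := T) hC2 hpos).mono hsub'
    refine this.congr fun t _ => ?_
    rfl
  -- dichotomy by the intermediate value theorem
  have hdich : (∀ t ∈ Ioo a' T, 2 + ε ≤ adaptedFrequency u G T t) ∨
      (∀ t ∈ Ioo a' T, adaptedFrequency u G T t ≤ 2 - ε) := by
    by_contra hcon
    push Not at hcon
    obtain ⟨⟨t₁, ht₁, h1⟩, ⟨t₂, ht₂, h2⟩⟩ := hcon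
    have h1' : adaptedFrequency u G T t₁ ≤ 2 - ε := by
      rcases le_abs.1 (hfar t₁ ht₁) with h | h
      · linarith
      · linarith
    have h2' : 2 + ε ≤ adaptedFrequency u G T t₂ := by
      rcases le_abs.1 (hfar t₂ ht₂) with h | h
      · linarith
      · linarith
    have hmem : (2 : ℝ) ∈ adaptedFrequency u G T '' Ioo a' T :=
      isPreconnected_Ioo.intermediate_value ht₁ ht₂ hcont ⟨by linarith, by linarith⟩
    obtain ⟨t, ht, hΛt⟩ := hmem
    have := hfar t ht
    rw [hΛt, sub_self, abs_zero] at this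
    linarith
  rcases hdich with hge | hle
  · have hev : ∀ᶠ t in 𝓝[<] T, ¬ adaptedFrequency u G T t < 2 + ε :=
      mem_of_superset (Ioo_mem_nhdsLT ha'T) fun t ht => not_lt.2 (hge t ht)
    exact Filter.not_frequently.2 hev
      (frequently_lt_two_add hν hT hcl hLH hdec hTI ht₀ hsing hker hcmp hε)
  · have hev : ∀ᶠ t in 𝓝[<] T, ¬ 2 - ε < adaptedFrequency u G T t :=
      mem_of_superset (Ioo_mem_nhdsLT ha'T) fun t ht => not_lt.2 (hle t ht)
    exact Filter.not_frequently.2 hev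
      (frequently_two_sub_lt hν hT hcl hLH hdec hTI ht₀ hsing hker hcmp hε)

/-- **The only possible limit is `2`.** Under the crux hypotheses, if the adapted frequency has
a limit `Λ₀` as `t ↑ T` then `Λ₀ = 2` (the backward-self-similar value).  So the crux
`AdaptedFrequencyConverges` is equivalent to `Λ → 2`. -/
theorem limit_eq_two (hν : 0 < ν) (hT : 0 < T)
    (hcl : IsClassicalNSSolutionOn (Ico 0 T) ν 0 u p) (hLH : IsLerayHopfOn T ν 0 (u 0) u)
    (hdec : HasRapidSpatialDecay (u 0)) (hTI : IsTypeIBlowup u T) (ht₀ : t₀ ∈ Ico 0 T)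
    (hsing : ∀ r : ℝ, 0 < r →
      eLpNorm (Function.uncurry u) ⊤ (volume.restrict (parabolicCylinder r (T, x₀))) = ⊤)
    (hker : IsAdaptedBackwardKernel ν u (Ico t₀ T) T x₀ G)
    (hcmp : IsGaussianComparable G (Ico t₀ T) T x₀) {Λ₀ : ℝ}
    (hlim : Tendsto (adaptedFrequency u G T) (𝓝[<] T) (𝓝 Λ₀)) : Λ₀ = 2 := by
  by_contra hne
  rcases lt_or_gt_of_ne hne with hlt | hgt
  · -- `Λ₀ < 2`: eventually `Λ < Λ₀ + δ = 2 − δ`, against `2 − δ < Λ` frequently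
    set δ : ℝ := (2 - Λ₀) / 2 with hδ
    have hδpos : 0 < δ := by rw [hδ]; linarith
    have hev : ∀ᶠ t in 𝓝[<] T, adaptedFrequency u G T t < Λ₀ + δ :=
      hlim.eventually (Iio_mem_nhds (by linarith))
    obtain ⟨t, h1, h2⟩ :=
      ((frequently_two_sub_lt hν hT hcl hLH hdec hTI ht₀ hsing hker hcmp hδpos).and_eventually
        hev).exists
    have : Λ₀ + δ = 2 - δ := by rw [hδ]; ring
    linarith
  · -- `Λ₀ > 2`: eventually `Λ > Λ₀ − δ = 2 + δ`, against `Λ < 2 + δ` frequently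
    set δ : ℝ := (Λ₀ - 2) / 2 with hδ
    have hδpos : 0 < δ := by rw [hδ]; linarith
    have hev : ∀ᶠ t in 𝓝[<] T, Λ₀ - δ < adaptedFrequency u G T t :=
      hlim.eventually (Ioi_mem_nhds (by linarith))
    obtain ⟨t, h1, h2⟩ :=
      ((frequently_lt_two_add hν hT hcl hLH hdec hTI ht₀ hsing hker hcmp hδpos).and_eventually
        hev).exists
    have : Λ₀ - δ = 2 + δ := by rw [hδ]; ring
    linarith

end Crux

/-! ### The same in the crux's own (inline) vocabulary -/

/-- **The only possible limit is `2` — crux vocabulary.** With the hypotheses of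
`AdaptedFrequency.AdaptedFrequencyConverges` spelled verbatim (the five kernel clauses and the
two-sided Gaussian comparability inline, `H t = ∫ ‖curl (u t) x‖² G t x`,
`Λ t = (T − t) · deriv H t / H t`): any limit `Λ₀` of `Λ` at `T⁻` equals `2`. -/
theorem limit_eq_two_inline : ∀ (ν T : ℝ), 0 < ν → 0 < T → ∀ (u : ℝ → EuclideanSpace ℝ (Fin 3) → EuclideanSpace ℝ (Fin 3)) (p : ℝ → EuclideanSpace ℝ (Fin 3) → ℝ), Literature.Analysis.FluidPDE.IsClassicalNSSolutionOn (Set.Ico 0 T) ν 0 u p → Literature.Analysis.FluidPDE.IsLerayHopfOn T ν 0 (u 0) u → Literature.Analysis.FluidPDE.HasRapidSpatialDecay (u 0) → Literature.Analysis.FluidPDE.IsTypeIBlowup u T → ∀ (x₀ : EuclideanSpace ℝ (Fin 3)) (t₀ : ℝ) (G : ℝ → EuclideanSpace ℝ (Fin 3) → ℝ), t₀ ∈ Set.Ico 0 T → (∀ r : ℝ, 0 < r → MeasureTheory.eLpNorm (Function.uncurry u) ⊤ (MeasureTheory.Measure.restrict MeasureTheory.volume (Literature.Analysis.FluidPDE.parabolicCylinder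 r (T, x₀))) = ⊤) → ContDiffOn ℝ 2 (Function.uncurry G) (Set.Ico t₀ T ×ˢ Set.univ) ∧ (∀ t ∈ Set.Ico t₀ T, ∀ x, 0 < G t x) ∧ (∀ t ∈ Set.Ico t₀ T, ∀ x, Literature.Analysis.FluidPDE.timeDerivWithin (Set.Ico t₀ T) G t x + fderiv ℝ (G t) x (u t x) + ν * Laplacian.laplacian (G t) x = 0) ∧ (∀ t ∈ Set.Ico t₀ T, ∫ x, G t x = 1) ∧ (∀ φ : EuclideanSpace ℝ (Fin 3) → ℝ, Continuous φ → (∃ M : ℝ, ∀ x, |φ x| ≤ M) → Filter.Tendsto (fun t => ∫ x, φ x * G t x) (nhdsWithin T (Set.Iio T)) (nhds (φ x₀))) → (∃ c₁ c₂ C₁ C₂ : ℝ, 0 < c₁ ∧ 0 < c₂ ∧ 0 < C₁ ∧ 0 < C₂ ∧ ∀ t ∈ Set.Ico t₀ T, ∀ x, c₁ * (T - t) ^ (-(3:ℝ) / 2) * Real.exp (-(‖x - x₀‖ ^ 2) / (c₂ * (T - t))) ≤ G t x ∧ G t x ≤ C₁ * (T - t) ^ (-(3:ℝ) / 2) * Real.exp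 (-(‖x - x₀‖ ^ 2) / (C₂ * (T - t)))) → ∀ H Λ : ℝ → ℝ, H = (fun t => ∫ x, ‖Literature.Analysis.FluidPDE.curl (u t) x‖ ^ 2 * G t x) → Λ = (fun t => (T - t) * deriv H t / H t) → ∀ Λ₀ : ℝ, Filter.Tendsto Λ (nhdsWithin T (Set.Iio T)) (nhds Λ₀) → Λ₀ = 2 := by
  intro ν T hν hT u p hcl hLH hdec hTI x₀ t₀ G ht₀ hsing hK hcomp H Λ hH hΛ Λ₀ hlim
  have hker : IsAdaptedBackwardKernel ν u (Ico t₀ T) T x₀ G := isAdaptedBackwardKernel_iff.2 hK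
  have hcmp : IsGaussianComparable G (Ico t₀ T) T x₀ := isGaussianComparable_iff_fin_three.2 hcomp
  have hH' : H = adaptedEnstrophy u G := by
    rw [hH]; funext t; rfl
  have hΛ' : Λ = adaptedFrequency u G T := by
    rw [hΛ, hH']; funext t; rfl
  rw [hΛ'] at hlim
  exact limit_eq_two hν hT hcl hLH hdec hTI ht₀ hsing hker hcmp hlim

/-- **The crux is equivalent to `Λ → 2`.** If `AdaptedFrequencyConverges` holds then, under its
hypotheses, the adapted frequency tends to `2` (not merely to some `Λ₀`) as `t ↑ T`. -/
theorem tendsto_two_of_adaptedFrequencyConverges (hAFC : AdaptedFrequencyConverges) {ν T t₀ : ℝ}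
    {u : ℝ → EuclideanSpace ℝ (Fin 3) → EuclideanSpace ℝ (Fin 3)}
    {p : ℝ → EuclideanSpace ℝ (Fin 3) → ℝ} {x₀ : EuclideanSpace ℝ (Fin 3)}
    {G : ℝ → EuclideanSpace ℝ (Fin 3) → ℝ} (hν : 0 < ν) (hT : 0 < T)
    (hcl : IsClassicalNSSolutionOn (Ico 0 T) ν 0 u p) (hLH : IsLerayHopfOn T ν 0 (u 0) u)
    (hdec : HasRapidSpatialDecay (u 0)) (hTI : IsTypeIBlowup u T) (ht₀ : t₀ ∈ Ico 0 T)
    (hsing : ∀ r : ℝ, 0 < r →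
      eLpNorm (Function.uncurry u) ⊤ (volume.restrict (parabolicCylinder r (T, x₀))) = ⊤)
    (hker : IsAdaptedBackwardKernel ν u (Ico t₀ T) T x₀ G)
    (hcmp : IsGaussianComparable G (Ico t₀ T) T x₀) :
    Tendsto (adaptedFrequency u G T) (𝓝[<] T) (𝓝 2) := by
  obtain ⟨Λ₀, hΛ₀⟩ := hAFC ν T hν hT u p hcl hLH hdec hTI x₀ t₀ G ht₀ hsing
    (isAdaptedBackwardKernel_iff.1 hker) (isGaussianComparable_iff_fin_three.1 hcmp)
    (adaptedEnstrophy u G) (adaptedFrequency u G T) (by funext t; rfl) (by funext t; rfl)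
  have h2 : Λ₀ = 2 := limit_eq_two hν hT hcl hLH hdec hTI ht₀ hsing hker hcmp hΛ₀
  rwa [h2] at hΛ₀

end Summit.NavierStokesRegularity.NavierStokesRegularity.Theorems.AdaptedFrequencyConverges.LimitTwo

end
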